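import Summits.Ventures.YMGap.RobustBall.BoundaryStateMarginal
import HarnessLib

/-!
# Venture YMGap, track ROBUST-BALL — «C-ENT-μμ» GENERIC LAYER: the relative entropy between the marginals of two DLR states on a finite region
# versus the relative entropy to an inner Gibbs law; `SU(N)` boundary-oscillation of the inner densities

HONEST FRAMING. WHAT THIS IS: a venture file (cell `pub-ymgap`, track Y2 ROBUST-BALL / DS, seat ds-3, theorems only, 0 compute). GENERIC (every compact
metrisable `G`, continuous `ρ`, every `d`, real couplings `b₁, b₂`, DLR states `μ₁`, `μ₂`, finite `Λ`, marginals `μᵢ|_Λ`, inner densities `p_{bᵢ,η}`):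
★★ `toReal_klDiv_map_restrict_map_restrict_sub_le` — `KL(μ₁|_Λ ‖ μ₂|_Λ)` is finite and `|KL(μ₁|_Λ ‖ μ₂|_Λ) − KL(μ₁|_Λ ‖ π_Λ^{b₂,η₀})| ≤ δ` whenever
`|log p_{b₂,η} − log p_{b₂,η₀}| ≤ δ` pointwise (both marginals are mixtures of inner Gibbs laws, `BoundaryStateMarginal`; Radon–Nikodym calculus of
`withDensity` measures). `SU(N)`, every `N`, every `d`, every real coupling: `suN_abs_action_glue_sub_glue_le`
(`|S_Λ(ζ ⊕ η) − S_Λ(ζ ⊕ η₀)| ≤ 2N·#∂T(Λ)`, `∂T(Λ) = {p ∈ T(Λ) : p ⊄ Λ}`) and `suN_abs_log_innerDensity_sub_le` (`δ = 4N|b|·#∂T(Λ)`).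
The `SU(2)`-on-`ℤ⁴` cells (relative entropy density between THE states at two couplings = Bregman divergence of the free energy) live in
`BoundaryStatesRelativeEntropySU2`, the every-`N`, every-`d` cells in `BoundaryStatesRelativeEntropyDim`.
WHAT THIS IS NOT: finite-region bookkeeping for lattice gauge DLR states; nothing about the continuum limit or Clay. Everything here is proved. [folklore]
-/

noncomputable section

open MeasureTheory ProbabilityTheory InformationTheory Filter Topology Real Finset Set
open scoped NNReal ENNReal
open Literature.Probability.LatticeModels hiding configShift configShift_apply
open Literature.MathematicalPhysics.QuantumLattice
open Literature.MathematicalPhysics.QuantumFieldTheory (haarProbability)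

namespace Summit.Ventures.YMGap.RobustBall

namespace BoundaryFreeEnergy

section Generic

variable {d N : ℕ} {G : Type*} [Group G] [TopologicalSpace G] [IsTopologicalGroup G] [CompactSpace G]
  [MeasurableSpace G] [BorelSpace G] [SecondCountableTopology G] (ρ : G →* Matrix (Fin N) (Fin N) ℂ)

/-- ★★ **RELATIVE ENTROPY BETWEEN THE MARGINALS OF TWO DLR STATES vs. RELATIVE ENTROPY TO AN INNER GIBBS LAW**: for DLR states `μ₁` (coupling `b₁`) and
`μ₂` (coupling `b₂`) and a finite `Λ`, `KL(μ₁|_Λ ‖ μ₂|_Λ)` is finite and, for every boundary field `η₀` and every `δ` with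
`|log p_{b₂,η}(ζ) − log p_{b₂,η₀}(ζ)| ≤ δ` for all `η, ζ`: `|KL(μ₁|_Λ ‖ μ₂|_Λ) − KL(μ₁|_Λ ‖ π_Λ^{b₂,η₀})| ≤ δ`. [folklore] -/
theorem toReal_klDiv_map_restrict_map_restrict_sub_le (hρ : Continuous ρ) (b₁ b₂ : ℝ) (Λ : Finset (ZdEdge d))
    {μ₁ μ₂ : Measure (LGConfig d G)} (hμ₁ : μ₁ ∈ ymGibbsMeasures ρ b₁) (hμ₂ : μ₂ ∈ ymGibbsMeasures ρ b₂) (η₀ : LGConfig d G) {δ : ℝ}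
    (hδ : ∀ (η : LGConfig d G) (ζ : ↥Λ → G),
      |Real.log (Real.exp (-b₂ * wilsonBoundaryAction ρ Λ (glueWith Λ ζ η)) /
          ∫ ζ', Real.exp (-b₂ * wilsonBoundaryAction ρ Λ (glueWith Λ ζ' η)) ∂(Measure.pi fun _ : ↥Λ => haarProbability G)) -
        Real.log (Real.exp (-b₂ * wilsonBoundaryAction ρ Λ (glueWith Λ ζ η₀)) /
          ∫ ζ', Real.exp (-b₂ * wilsonBoundaryAction ρ Λ (glueWith Λ ζ' η₀)) ∂(Measure.pi fun _ : ↥Λ => haarProbability G))| ≤ δ) :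
    klDiv (μ₁.map (fun U (e : ↥Λ) => U e)) (μ₂.map (fun U (e : ↥Λ) => U e)) ≠ ∞ ∧
    |(klDiv (μ₁.map (fun U (e : ↥Λ) => U e)) (μ₂.map (fun U (e : ↥Λ) => U e))).toReal -
        (klDiv (μ₁.map (fun U (e : ↥Λ) => U e)) ((Measure.pi fun _ : ↥Λ => haarProbability G).tilted
          (fun ζ => -b₂ * wilsonBoundaryAction ρ Λ (glueWith Λ ζ η₀)))).toReal| ≤ δ := by
  set H : Measure (↥Λ → G) := Measure.pi fun _ : ↥Λ => haarProbability G with hH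
  haveI : IsProbabilityMeasure H := by rw [hH]; infer_instance
  have hG₁ : IsGibbsMeasure (ymSpecification ρ b₁) μ₁ := hμ₁
  have hG₂ : IsGibbsMeasure (ymSpecification ρ b₂) μ₂ := hμ₂
  haveI := hG₁.isProbabilityMeasure
  haveI := hG₂.isProbabilityMeasure
  have hr : Measurable fun (U : LGConfig d G) (e : ↥Λ) => U e := measurable_pi_lambda _ fun e => measurable_pi_apply _
  haveI : IsProbabilityMeasure (μ₁.map (fun U (e : ↥Λ) => U e)) := Measure.isProbabilityMeasure_map hr.aemeasurable
  haveI : IsProbabilityMeasure (μ₂.map (fun U (e : ↥Λ) => U e)) := Measure.isProbabilityMeasure_map hr.aemeasurable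
  -- the two inner densities and their mixtures
  set p₁ : LGConfig d G × (↥Λ → G) → ℝ := fun q => Real.exp (-b₁ * wilsonBoundaryAction ρ Λ (glueWith Λ q.2 q.1)) /
      ∫ ζ, Real.exp (-b₁ * wilsonBoundaryAction ρ Λ (glueWith Λ ζ q.1)) ∂H with hp₁
  set p₂ : LGConfig d G × (↥Λ → G) → ℝ := fun q => Real.exp (-b₂ * wilsonBoundaryAction ρ Λ (glueWith Λ q.2 q.1)) /
      ∫ ζ, Real.exp (-b₂ * wilsonBoundaryAction ρ Λ (glueWith Λ ζ q.1)) ∂H with hp₂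
  have hp₁m : Measurable p₁ := measurable_innerDensity ρ hρ b₁ Λ
  have hp₂m : Measurable p₂ := measurable_innerDensity ρ hρ b₂ Λ
  obtain ⟨C, hC⟩ := exists_bound_of_continuous (continuous_wilsonBoundaryAction (G := G) ρ hρ Λ)
  have hp₁b : ∀ q, p₁ q ∈ Set.Icc (Real.exp (-(2 * |b₁| * C))) (Real.exp (2 * |b₁| * C)) := fun q =>
    innerDensity_mem_Icc ρ hρ b₁ Λ hC q.1 q.2
  have hp₂b : ∀ q, p₂ q ∈ Set.Icc (Real.exp (-(2 * |b₂| * C))) (Real.exp (2 * |b₂| * C)) := fun q =>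
    innerDensity_mem_Icc ρ hρ b₂ Λ hC q.1 q.2
  set lo₁ := Real.exp (-(2 * |b₁| * C)); set hi₁ := Real.exp (2 * |b₁| * C); set lo₂ := Real.exp (-(2 * |b₂| * C)); set hi₂ := Real.exp (2 * |b₂| * C)
  have hlo₁ : 0 < lo₁ := Real.exp_pos _; have hlo₂ : 0 < lo₂ := Real.exp_pos _
  set ρ₁ : (↥Λ → G) → ℝ := fun ζ => ∫ η, p₁ (η, ζ) ∂μ₁ with hρ₁
  set ρ₂ : (↥Λ → G) → ℝ := fun ζ => ∫ η, p₂ (η, ζ) ∂μ₂ with hρ₂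
  have hρ₁m : Measurable ρ₁ := (hp₁m.stronglyMeasurable.integral_prod_left' (μ := μ₁)).measurable
  have hρ₂m : Measurable ρ₂ := (hp₂m.stronglyMeasurable.integral_prod_left' (μ := μ₂)).measurable
  have hint₁ : ∀ ζ, Integrable (fun η => p₁ (η, ζ)) μ₁ := fun ζ =>
    Integrable.of_bound (hp₁m.comp (measurable_id.prodMk measurable_const)).aestronglyMeasurable hi₁
      (ae_of_all _ fun η => by rw [Real.norm_eq_abs, abs_of_nonneg (hlo₁.le.trans (hp₁b (η, ζ)).1)]; exact (hp₁b (η, ζ)).2)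
  have hint₂ : ∀ ζ, Integrable (fun η => p₂ (η, ζ)) μ₂ := fun ζ =>
    Integrable.of_bound (hp₂m.comp (measurable_id.prodMk measurable_const)).aestronglyMeasurable hi₂
      (ae_of_all _ fun η => by rw [Real.norm_eq_abs, abs_of_nonneg (hlo₂.le.trans (hp₂b (η, ζ)).1)]; exact (hp₂b (η, ζ)).2)
  have hρ₁b : ∀ ζ, ρ₁ ζ ∈ Set.Icc lo₁ hi₁ := fun ζ =>
    ⟨by simpa using integral_mono (integrable_const lo₁) (hint₁ ζ) fun η => (hp₁b (η, ζ)).1,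
      by simpa using integral_mono (hint₁ ζ) (integrable_const hi₁) fun η => (hp₁b (η, ζ)).2⟩
  -- the mixture ρ₂ is within e^{±δ} of p₂(η₀, ·)
  have hρ₂b : ∀ ζ, Real.exp (-δ) * p₂ (η₀, ζ) ≤ ρ₂ ζ ∧ ρ₂ ζ ≤ Real.exp δ * p₂ (η₀, ζ) := fun ζ => by
    have hpt : ∀ η, Real.exp (-δ) * p₂ (η₀, ζ) ≤ p₂ (η, ζ) ∧ p₂ (η, ζ) ≤ Real.exp δ * p₂ (η₀, ζ) := fun η => by
      have hq0 : 0 < p₂ (η₀, ζ) := hlo₂.trans_le (hp₂b (η₀, ζ)).1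
      have hq : 0 < p₂ (η, ζ) := hlo₂.trans_le (hp₂b (η, ζ)).1
      have h := hδ η ζ
      rw [← Real.log_div hq.ne' hq0.ne', abs_le] at h
      have e1 : p₂ (η, ζ) = (p₂ (η, ζ) / p₂ (η₀, ζ)) * p₂ (η₀, ζ) := by field_simp
      constructor
      · rw [e1]; refine mul_le_mul_of_nonneg_right ?_ hq0.le
        calc Real.exp (-δ) ≤ Real.exp (Real.log (p₂ (η, ζ) / p₂ (η₀, ζ))) := Real.exp_le_exp.2 h.1
          _ = _ := Real.exp_log (div_pos hq hq0)
      · rw [e1]; refine mul_le_mul_of_nonneg_right ?_ hq0.le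
        calc p₂ (η, ζ) / p₂ (η₀, ζ) = Real.exp (Real.log (p₂ (η, ζ) / p₂ (η₀, ζ))) := (Real.exp_log (div_pos hq hq0)).symm
          _ ≤ Real.exp δ := Real.exp_le_exp.2 h.2
    exact ⟨by simpa using integral_mono (integrable_const (Real.exp (-δ) * p₂ (η₀, ζ))) (hint₂ ζ) fun η => (hpt η).1,
      by simpa using integral_mono (hint₂ ζ) (integrable_const (Real.exp δ * p₂ (η₀, ζ))) fun η => (hpt η).2⟩
  have hρ₂pos : ∀ ζ, 0 < ρ₂ ζ := fun ζ =>
    lt_of_lt_of_le (mul_pos (Real.exp_pos _) (hlo₂.trans_le (hp₂b (η₀, ζ)).1)) (hρ₂b ζ).1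
  have hlogρ₂ : ∀ ζ, |Real.log (p₂ (η₀, ζ)) - Real.log (ρ₂ ζ)| ≤ δ := fun ζ => by
    have hq0 : 0 < p₂ (η₀, ζ) := hlo₂.trans_le (hp₂b (η₀, ζ)).1
    have h1 := Real.log_le_log (mul_pos (Real.exp_pos _) hq0) (hρ₂b ζ).1; have h2 := Real.log_le_log (hρ₂pos ζ) (hρ₂b ζ).2
    rw [Real.log_mul (Real.exp_pos _).ne' hq0.ne', Real.log_exp] at h1 h2; rw [abs_le]; constructor <;> linarith
  -- the marginals as withDensity measures
  have hmap₁ : μ₁.map (fun U (e : ↥Λ) => U e) = H.withDensity fun ζ => ENNReal.ofReal (ρ₁ ζ) := map_restrict_eq_withDensity ρ hρ b₁ Λ hμ₁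
  have hmap₂ : μ₂.map (fun U (e : ↥Λ) => U e) = H.withDensity fun ζ => ENNReal.ofReal (ρ₂ ζ) := map_restrict_eq_withDensity ρ hρ b₂ Λ hμ₂
  have hf₂m : Measurable fun ζ => ENNReal.ofReal (ρ₂ ζ) := ENNReal.measurable_ofReal.comp hρ₂m
  have hac₁H : μ₁.map (fun U (e : ↥Λ) => U e) ≪ H := by rw [hmap₁]; exact withDensity_absolutelyContinuous _ _
  have hHμ₂ : H ≪ μ₂.map (fun U (e : ↥Λ) => U e) := by
    rw [hmap₂]; exact withDensity_absolutelyContinuous' hf₂m.aemeasurable (ae_of_all _ fun ζ => (ENNReal.ofReal_pos.2 (hρ₂pos ζ)).ne')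
  have hac : μ₁.map (fun U (e : ↥Λ) => U e) ≪ μ₂.map (fun U (e : ↥Λ) => U e) := hac₁H.trans hHμ₂
  -- the Radon–Nikodym derivative dμ₁Λ/dμ₂Λ = ρ₁/ρ₂
  have hrn₁ : (μ₁.map (fun U (e : ↥Λ) => U e)).rnDeriv H =ᵐ[H] fun ζ => ENNReal.ofReal (ρ₁ ζ) := by
    rw [hmap₁]; exact Measure.rnDeriv_withDensity H (ENNReal.measurable_ofReal.comp hρ₁m)
  have hrn : (μ₁.map (fun U (e : ↥Λ) => U e)).rnDeriv (μ₂.map (fun U (e : ↥Λ) => U e)) =ᵐ[H]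
      fun ζ => (ENNReal.ofReal (ρ₂ ζ))⁻¹ * ENNReal.ofReal (ρ₁ ζ) := by
    have h := Measure.rnDeriv_withDensity_right (μ₁.map (fun U (e : ↥Λ) => U e)) H hf₂m.aemeasurable
      (ae_of_all _ fun ζ => (ENNReal.ofReal_pos.2 (hρ₂pos ζ)).ne') (ae_of_all _ fun ζ => ENNReal.ofReal_ne_top)
    rw [← hmap₂] at h
    filter_upwards [h, hrn₁] with ζ hζ hζ1
    rw [hζ, hζ1]
  have hllr : llr (μ₁.map (fun U (e : ↥Λ) => U e)) (μ₂.map (fun U (e : ↥Λ) => U e)) =ᵐ[μ₁.map (fun U (e : ↥Λ) => U e)]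
      fun ζ => Real.log (ρ₁ ζ) - Real.log (ρ₂ ζ) := by
    filter_upwards [hac₁H.ae_le hrn] with ζ hζ
    rw [llr, hζ, ENNReal.toReal_mul, ENNReal.toReal_inv, ENNReal.toReal_ofReal (hρ₂pos ζ).le,
      ENNReal.toReal_ofReal (hlo₁.le.trans (hρ₁b ζ).1), inv_mul_eq_div, Real.log_div (hlo₁.trans_le (hρ₁b ζ).1).ne' (hρ₂pos ζ).ne']
  -- bounded llr ⇒ integrable, finite KL, integral formula
  have hlog₁b : ∀ ζ, |Real.log (ρ₁ ζ)| ≤ 2 * |b₁| * C := fun ζ => by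
    rw [abs_le]; constructor
    · have h := Real.log_le_log hlo₁ (hρ₁b ζ).1; rw [Real.log_exp] at h; linarith
    · have h := Real.log_le_log (hlo₁.trans_le (hρ₁b ζ).1) (hρ₁b ζ).2; rw [Real.log_exp] at h; linarith
  have hlog₂b : ∀ ζ, |Real.log (ρ₂ ζ)| ≤ 2 * |b₂| * C + δ := fun ζ => by
    have hq0 := hp₂b (η₀, ζ)
    have hl : |Real.log (p₂ (η₀, ζ))| ≤ 2 * |b₂| * C := by
      rw [abs_le]; constructor
      · have h := Real.log_le_log hlo₂ hq0.1; rw [Real.log_exp] at h; linarith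
      · have h := Real.log_le_log (hlo₂.trans_le hq0.1) hq0.2; rw [Real.log_exp] at h; linarith
    have h := hlogρ₂ ζ
    rw [abs_le] at hl h ⊢; constructor <;> linarith
  have hint : Integrable (llr (μ₁.map (fun U (e : ↥Λ) => U e)) (μ₂.map (fun U (e : ↥Λ) => U e))) (μ₁.map (fun U (e : ↥Λ) => U e)) := by
    refine (integrable_congr hllr).2 (Integrable.of_bound ((Real.measurable_log.comp hρ₁m).sub (Real.measurable_log.comp hρ₂m)).aestronglyMeasurable
      (2 * |b₁| * C + (2 * |b₂| * C + δ)) (ae_of_all _ fun ζ => ?_))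
    rw [Real.norm_eq_abs]
    exact (abs_sub _ _).trans (add_le_add (hlog₁b ζ) (hlog₂b ζ))
  refine ⟨klDiv_ne_top hac hint, ?_⟩
  have hKL : (klDiv (μ₁.map (fun U (e : ↥Λ) => U e)) (μ₂.map (fun U (e : ↥Λ) => U e))).toReal =
      ∫ ζ, (Real.log (ρ₁ ζ) - Real.log (ρ₂ ζ)) ∂(μ₁.map (fun U (e : ↥Λ) => U e)) := by
    rw [toReal_klDiv_of_measure_eq hac (by simp), integral_congr_ae hllr]
  -- KL to the inner Gibbs law at (b₂, η₀): ∫ (log ρ₁ − log p₂(η₀,·))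
  set g : (↥Λ → G) → ℝ := fun ζ => -b₂ * wilsonBoundaryAction ρ Λ (glueWith Λ ζ η₀) with hg
  have hexp : Integrable (fun ζ => Real.exp (g ζ)) H := integrable_exp_neg_mul_action_glueWith ρ hρ b₂ Λ η₀ H
  haveI : IsProbabilityMeasure (H.tilted g) := isProbabilityMeasure_tilted hexp
  have hacπ : μ₁.map (fun U (e : ↥Λ) => U e) ≪ H.tilted g := hac₁H.trans (absolutelyContinuous_tilted hexp)
  have hllrπ : llr (μ₁.map (fun U (e : ↥Λ) => U e)) (H.tilted g) =ᵐ[μ₁.map (fun U (e : ↥Λ) => U e)]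
      fun ζ => Real.log (ρ₁ ζ) - Real.log (p₂ (η₀, ζ)) := by
    have h1 := llr_tilted_right hac₁H hexp
    have h2 : llr (μ₁.map (fun U (e : ↥Λ) => U e)) H =ᵐ[μ₁.map (fun U (e : ↥Λ) => U e)] fun ζ => Real.log (ρ₁ ζ) := by
      filter_upwards [hac₁H.ae_le hrn₁] with ζ hζ
      rw [llr, hζ, ENNReal.toReal_ofReal (hlo₁.le.trans (hρ₁b ζ).1)]
    filter_upwards [h1, h2] with ζ hζ hζ2
    rw [hζ, hζ2]
    have hZpos : 0 < ∫ x, Real.exp (g x) ∂H := integral_exp_pos hexp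
    have e : Real.log (p₂ (η₀, ζ)) = g ζ - Real.log (∫ x, Real.exp (g x) ∂H) := by
      rw [hp₂]; dsimp only; rw [Real.log_div (Real.exp_pos _).ne' hZpos.ne', Real.log_exp]
    rw [e]; ring
  have hSc : Continuous (wilsonBoundaryAction (G := G) ρ Λ) := continuous_wilsonBoundaryAction ρ hρ Λ
  have hgm : Measurable g := (hSc.measurable.comp (measurable_glueWith Λ η₀)).const_mul _
  have hgint : Integrable g (μ₁.map (fun U (e : ↥Λ) => U e)) := integrable_of_bound hgm.aestronglyMeasurable (C := |b₂| * C) fun ζ => by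
    rw [hg]; dsimp only; rw [abs_mul, abs_neg]; exact mul_le_mul_of_nonneg_left (hC _) (abs_nonneg _)
  have hint₁H : Integrable (llr (μ₁.map (fun U (e : ↥Λ) => U e)) H) (μ₁.map (fun U (e : ↥Λ) => U e)) :=
    (map_restrict_ac_integrable_llr ρ hρ b₁ Λ hμ₁).2
  have hKLπ : (klDiv (μ₁.map (fun U (e : ↥Λ) => U e)) (H.tilted g)).toReal =
      ∫ ζ, (Real.log (ρ₁ ζ) - Real.log (p₂ (η₀, ζ))) ∂(μ₁.map (fun U (e : ↥Λ) => U e)) := by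
    rw [toReal_klDiv_of_measure_eq hacπ (by simp), integral_congr_ae hllrπ]
  -- the difference of the two integrals is ∫ (log p₂(η₀,·) − log ρ₂) ≤ δ
  have hi1 : Integrable (fun ζ => Real.log (ρ₁ ζ) - Real.log (ρ₂ ζ)) (μ₁.map (fun U (e : ↥Λ) => U e)) := (integrable_congr hllr).1 hint
  have hi2 : Integrable (fun ζ => Real.log (ρ₁ ζ) - Real.log (p₂ (η₀, ζ))) (μ₁.map (fun U (e : ↥Λ) => U e)) :=
    (integrable_congr hllrπ).1 (integrable_llr_tilted_right hac₁H hgint hint₁H hexp)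
  rw [hKL, hKLπ, ← integral_sub hi1 hi2]
  have h := norm_integral_le_of_norm_le_const (μ := μ₁.map (fun U (e : ↥Λ) => U e)) (C := δ)
    (f := fun ζ => (Real.log (ρ₁ ζ) - Real.log (ρ₂ ζ)) - (Real.log (ρ₁ ζ) - Real.log (p₂ (η₀, ζ))))
    (ae_of_all _ fun ζ => by
      rw [Real.norm_eq_abs, show (Real.log (ρ₁ ζ) - Real.log (ρ₂ ζ)) - (Real.log (ρ₁ ζ) - Real.log (p₂ (η₀, ζ))) =
        Real.log (p₂ (η₀, ζ)) - Real.log (ρ₂ ζ) by ring]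
      exact hlogρ₂ ζ)
  rw [Real.norm_eq_abs] at h
  simpa using h

end Generic

/-! ### `SU(N)`: the inner densities depend on the boundary field only through the boundary plaquettes -/

section SUN

variable {d N : ℕ}

/-- **Two outer fields change the action by at most `2N` per boundary plaquette**: `|S_Λ(ζ ⊕ η) − S_Λ(ζ ⊕ η₀)| ≤ 2N·#{p ∈ T(Λ) : p ⊄ Λ}`
(interior plaquettes read only the inner links `ζ`). [folklore] -/
theorem suN_abs_action_glue_sub_glue_le (Λ : Finset (ZdEdge d)) (ζ : ↥Λ → SUN N) (η η₀ : LGConfig d (SUN N)) :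
    |wilsonBoundaryAction (fundamentalRep (Fin N)) Λ (glueWith Λ ζ η) - wilsonBoundaryAction (fundamentalRep (Fin N)) Λ (glueWith Λ ζ η₀)| ≤
      2 * N * ((plaquettesTouching Λ).filter fun p => ¬plaquetteEdges p ⊆ Λ).card := by
  classical
  set V := glueWith Λ ζ η with hV
  set V₀ := glueWith Λ ζ η₀ with hV₀
  have hVV : ∀ e ∈ Λ, V e = V₀ e := fun e he => by rw [hV, hV₀, glueWith_apply_mem _ _ _ he, glueWith_apply_mem _ _ _ he]
  have hdiff : wilsonBoundaryAction (fundamentalRep (Fin N)) Λ V - wilsonBoundaryAction (fundamentalRep (Fin N)) Λ V₀ =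
      ∑ p ∈ (plaquettesTouching Λ).filter (fun p => ¬plaquetteEdges p ⊆ Λ),
        (plaquetteObs (fundamentalRep (Fin N)) p.1 p.2.1.1 p.2.1.2 V₀ - plaquetteObs (fundamentalRep (Fin N)) p.1 p.2.1.1 p.2.1.2 V) := by
    unfold wilsonBoundaryAction
    rw [← Finset.sum_sub_distrib, ← Finset.sum_filter_add_sum_filter_not (plaquettesTouching Λ) (fun p => plaquetteEdges p ⊆ Λ)]
    have h0 : ∑ p ∈ (plaquettesTouching Λ).filter (fun p => plaquetteEdges p ⊆ Λ),
        (((N : ℝ) - plaquetteObs (fundamentalRep (Fin N)) p.1 p.2.1.1 p.2.1.2 V) -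
          ((N : ℝ) - plaquetteObs (fundamentalRep (Fin N)) p.1 p.2.1.1 p.2.1.2 V₀)) = 0 := by
      refine Finset.sum_eq_zero fun p hp => ?_
      have hsub : plaquetteEdges p ⊆ Λ := (Finset.mem_filter.1 hp).2
      have heq : plaquetteObs (fundamentalRep (Fin N)) p.1 p.2.1.1 p.2.1.2 V = plaquetteObs (fundamentalRep (Fin N)) p.1 p.2.1.1 p.2.1.2 V₀ :=
        isCylinder_plaquetteObs (fundamentalRep (Fin N)) p (fun e he => hVV e (hsub (Finset.mem_coe.1 he)))
      rw [heq, sub_self]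
    rw [h0, zero_add]
    exact Finset.sum_congr rfl fun p _ => by ring
  rw [hdiff]
  refine (Finset.abs_sum_le_sum_abs _ _).trans ?_
  refine (Finset.sum_le_card_nsmul _ _ (2 * (N : ℝ)) fun p _ => ?_).trans (by rw [nsmul_eq_mul]; ring_nf; rfl)
  have h1 := abs_plaquetteObs_le_holds (fundamentalRep (Fin N)) fundamentalRep_mem_unitaryGroup p.1 p.2.1.1 p.2.1.2 V₀
  have h2 := abs_plaquetteObs_le_holds (fundamentalRep (Fin N)) fundamentalRep_mem_unitaryGroup p.1 p.2.1.1 p.2.1.2 V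
  calc |plaquetteObs (fundamentalRep (Fin N)) p.1 p.2.1.1 p.2.1.2 V₀ - plaquetteObs (fundamentalRep (Fin N)) p.1 p.2.1.1 p.2.1.2 V|
      ≤ |plaquetteObs (fundamentalRep (Fin N)) p.1 p.2.1.1 p.2.1.2 V₀| + |plaquetteObs (fundamentalRep (Fin N)) p.1 p.2.1.1 p.2.1.2 V| :=
        abs_sub _ _
    _ ≤ N + N := add_le_add h1 h2
    _ = 2 * N := by ring

/-- **The inner density depends on the boundary field only through the boundary plaquettes**: for every real `b`, all `η, η₀, ζ`,
`|log p_{b,η}(ζ) − log p_{b,η₀}(ζ)| ≤ 4N|b|·#{p ∈ T(Λ) : p ⊄ Λ}` (`2N|b|·#∂T` from the exponent, `2N|b|·#∂T` from the normalisers). [folklore] -/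
theorem suN_abs_log_innerDensity_sub_le (b : ℝ) (Λ : Finset (ZdEdge d)) (η η₀ : LGConfig d (SUN N)) (ζ : ↥Λ → SUN N) :
    |Real.log (Real.exp (-b * wilsonBoundaryAction (fundamentalRep (Fin N)) Λ (glueWith Λ ζ η)) /
        ∫ ζ', Real.exp (-b * wilsonBoundaryAction (fundamentalRep (Fin N)) Λ (glueWith Λ ζ' η)) ∂(Measure.pi fun _ : ↥Λ => haarProbability (SUN N))) -
      Real.log (Real.exp (-b * wilsonBoundaryAction (fundamentalRep (Fin N)) Λ (glueWith Λ ζ η₀)) /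
        ∫ ζ', Real.exp (-b * wilsonBoundaryAction (fundamentalRep (Fin N)) Λ (glueWith Λ ζ' η₀)) ∂(Measure.pi fun _ : ↥Λ => haarProbability (SUN N)))| ≤
      4 * N * |b| * ((plaquettesTouching Λ).filter fun p => ¬plaquetteEdges p ⊆ Λ).card := by
  haveI : SecondCountableTopology (Matrix.specialUnitaryGroup (Fin N) ℂ) :=
    haveI : SecondCountableTopology (Matrix (Fin N) (Fin N) ℂ) := inferInstanceAs (SecondCountableTopology (Fin N → Fin N → ℂ))
    Topology.IsEmbedding.subtypeVal.secondCountableTopology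
  have hρc : Continuous (fundamentalRep (Fin N)) := continuous_fundamentalRep (Fin N)
  set H : Measure (↥Λ → SUN N) := Measure.pi fun _ : ↥Λ => haarProbability (SUN N) with hH
  haveI : IsProbabilityMeasure H := by rw [hH]; infer_instance
  set D : ℝ := (((plaquettesTouching Λ).filter fun p => ¬plaquetteEdges p ⊆ Λ).card : ℝ) with hD
  set S : LGConfig d (SUN N) → ℝ := wilsonBoundaryAction (fundamentalRep (Fin N)) Λ with hS
  have hbd : ∀ ζ' : ↥Λ → SUN N, |(-b) * S (glueWith Λ ζ' η) - (-b) * S (glueWith Λ ζ' η₀)| ≤ |b| * (2 * N * D) := fun ζ' => by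
    rw [← mul_sub, abs_mul, abs_neg]
    exact mul_le_mul_of_nonneg_left (suN_abs_action_glue_sub_glue_le (N := N) Λ ζ' η η₀) (abs_nonneg b)
  have hiη : Integrable (fun ζ' => Real.exp (-b * S (glueWith Λ ζ' η))) H := integrable_exp_neg_mul_action_glueWith _ hρc b Λ η H
  have hiη₀ : Integrable (fun ζ' => Real.exp (-b * S (glueWith Λ ζ' η₀))) H := integrable_exp_neg_mul_action_glueWith _ hρc b Λ η₀ H
  set Z := ∫ ζ', Real.exp (-b * S (glueWith Λ ζ' η)) ∂H with hZ
  set Z₀ := ∫ ζ', Real.exp (-b * S (glueWith Λ ζ' η₀)) ∂H with hZ₀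
  have hZpos : 0 < Z := integral_exp_pos hiη
  have hZ₀pos : 0 < Z₀ := integral_exp_pos hiη₀
  -- the normalisers are within a factor e^{|b|·2N·D}
  have hZle : Z ≤ Real.exp (|b| * (2 * N * D)) * Z₀ := by
    rw [hZ₀, ← integral_const_mul]
    refine integral_mono hiη (hiη₀.const_mul _) fun ζ' => ?_
    show Real.exp (-b * S (glueWith Λ ζ' η)) ≤ Real.exp (|b| * (2 * N * D)) * Real.exp (-b * S (glueWith Λ ζ' η₀))
    rw [← Real.exp_add]; exact Real.exp_le_exp.2 (by linarith [(abs_le.1 (hbd ζ')).2])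
  have hZ₀le : Z₀ ≤ Real.exp (|b| * (2 * N * D)) * Z := by
    rw [hZ, ← integral_const_mul]
    refine integral_mono hiη₀ (hiη.const_mul _) fun ζ' => ?_
    show Real.exp (-b * S (glueWith Λ ζ' η₀)) ≤ Real.exp (|b| * (2 * N * D)) * Real.exp (-b * S (glueWith Λ ζ' η))
    rw [← Real.exp_add]; exact Real.exp_le_exp.2 (by linarith [(abs_le.1 (hbd ζ')).1])
  have hlogZ : |Real.log Z - Real.log Z₀| ≤ |b| * (2 * N * D) := by
    have h1 := Real.log_le_log hZpos hZle
    have h2 := Real.log_le_log hZ₀pos hZ₀le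
    rw [Real.log_mul (Real.exp_pos _).ne' hZ₀pos.ne', Real.log_exp] at h1
    rw [Real.log_mul (Real.exp_pos _).ne' hZpos.ne', Real.log_exp] at h2
    rw [abs_le]; constructor <;> linarith
  rw [Real.log_div (Real.exp_pos _).ne' hZpos.ne', Real.log_div (Real.exp_pos _).ne' hZ₀pos.ne', Real.log_exp, Real.log_exp]
  have h := hbd ζ
  rw [abs_le] at h hlogZ ⊢
  constructor <;> nlinarith [h.1, h.2, hlogZ.1, hlogZ.2]

end SUN

end BoundaryFreeEnergy

end Summit.Ventures.YMGap.RobustBall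

end
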